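import Summits.AnomalousDissipation.AnomalousDissipation.Theorems.SawtoothPulseCascadeApproxEnvelope58

/-!
# The `L²` envelope of the forced linearised response on the box (S1 of the line `linear-response-lip`)
(route `AnomalousDissipation/SawtoothPulseCascade`; helper for the crux ApproxSol58 =
stmt-AnomalousDissipation-19688)

**Theorem (`responseL2Envelope`).**  For `(γ, ρN) ∈ [5,8] × {2,…,7}`, assuming the per-phase cap K2″
`K2PhaseGrowthClassical ⟨γ,1/4,2,1,ρN⟩ 3`: with `M₂ = max (3e^{σ⋆γ}) (2ρN) < γ² − 3` and `K = (96√π + 24√(2π))γ`,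
for every lag `A` there is `ν₀ > 0` such that for all `ν ∈ (0, ν₀]`, every window `[0, T']`,
`horizon (γ²−3) ν A < T' < 1`, and every classical solution `(L, q)` of the heat-lag-forced linearised equations
on `[0, T']` from zero: `√∫‖L(t)‖² ≤ K ν (j+1) M₂^{j+1}` for `t ≤ horizon` in phase `j`.

This is the time-resolved envelope S1 `stub_responseL2Envelope` of the lead's reshape (with the response
hypotheses spelled out); the registered `stub_responseL2` (its time integral `≤ εν`) is derived in the sequel.
Pipeline: slot-wise Duhamel (`…ApproxDuhamel`) + backward realignment via the sharper Gaussian profile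
(`…ApproxRealign`) + K2″ per piece (`…ApproxPieces`) + the budget `16π²νN_j²tHalf_j ≤ δ_j²` up to the horizon
phase (`…ApproxEnvelope58.budget_threshold`) + the window `3e^{σ⋆γ} < γ² − 3` (`DriftFree.driftFreeWindow58`).
-/

set_option linter.dupNamespace false

noncomputable section

namespace Summit.AnomalousDissipation.AnomalousDissipation.Theorems.SawtoothPulseCascade.ApproxResponse

open Set MeasureTheory UnitAddTorus
open scoped ContDiff InnerProductSpace
open Literature.Analysis Literature.Analysis.FunctionSpaces Literature.Analysis.FluidPDE
open Literature.Analysis.FluidPDE.SawtoothCascade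
open Literature.Analysis.FluidPDE.SawtoothCascade.CascadeParams
open Summit.AnomalousDissipation.AnomalousDissipation.Theorems.SawtoothPulseCascade.K2Classical

/-! ## §1 Locating the slot of a time -/

/-- Every `t ∈ [0, σ K]` (`K ≥ 1`) lies in some slot `k < K`, and either `k = 0` or `t` is strictly after the
start of phase `k/2`. -/
theorem exists_slot {t : ℝ} (ht0 : 0 ≤ t) {K : ℕ} (hK : 0 < K)
    (htK : t ≤ CascadeParams.tInject (K / 2) (K % 2 == 0)) :
    ∃ k < K, t ∈ Icc (CascadeParams.tInject (k / 2) (k % 2 == 0))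
      (CascadeParams.tInject ((k + 1) / 2) ((k + 1) % 2 == 0)) ∧ (k = 0 ∨ tStart (k / 2) < t) := by
  classical
  have hex : ∃ k : ℕ, t ≤ CascadeParams.tInject ((k + 1) / 2) ((k + 1) % 2 == 0) :=
    ⟨K - 1, by rwa [Nat.sub_add_cancel hK]⟩
  set k₀ := Nat.find hex with hk₀
  have hk₀spec : t ≤ CascadeParams.tInject ((k₀ + 1) / 2) ((k₀ + 1) % 2 == 0) := Nat.find_spec hex
  have hk₀le : k₀ ≤ K - 1 := Nat.find_min' hex (by rwa [Nat.sub_add_cancel hK])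
  refine ⟨k₀, by omega, ⟨?_, hk₀spec⟩, ?_⟩
  · rcases Nat.eq_zero_or_pos k₀ with h0 | hpos
    · rw [h0, slotStart_zero]; exact ht0
    · obtain ⟨k', hk'⟩ := Nat.exists_eq_succ_of_ne_zero (Nat.pos_iff_ne_zero.1 hpos)
      have hmin := Nat.find_min hex (show k' < k₀ by omega)
      rw [hk', Nat.succ_eq_add_one]
      exact (lt_of_not_ge hmin).le
  · rcases Nat.eq_zero_or_pos k₀ with h0 | hpos
    · exact Or.inl h0
    · right
      obtain ⟨k', hk'⟩ := Nat.exists_eq_succ_of_ne_zero (Nat.pos_iff_ne_zero.1 hpos)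
      have hmin := Nat.find_min hex (show k' < k₀ by omega)
      rw [hk', Nat.succ_eq_add_one]
      have hlt : CascadeParams.tInject ((k' + 1) / 2) ((k' + 1) % 2 == 0) < t := lt_of_not_ge hmin
      exact (tStart_half_le_slotStart (k' + 1)).trans_lt hlt

/-- Monotonicity of the envelope shape `(j+1) M^{j+1}` in `j` (`M ≥ 1`). -/
theorem envelope_mono {M : ℝ} (hM : 1 ≤ M) {a b : ℕ} (hab : a ≤ b) :
    ((a : ℝ) + 1) * M ^ (a + 1) ≤ ((b : ℝ) + 1) * M ^ (b + 1) := by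
  have h1 : (a : ℝ) + 1 ≤ (b : ℝ) + 1 := by exact_mod_cast Nat.succ_le_succ hab
  have h2 : M ^ (a + 1) ≤ M ^ (b + 1) := pow_le_pow_right₀ hM (by omega)
  have h3 : (0 : ℝ) ≤ (a : ℝ) + 1 := by positivity
  have h4 : 0 ≤ M ^ (b + 1) := by positivity
  nlinarith


/-! ## §2 The envelope on the box -/

/-- **The geometric `L²` envelope of the forced linearised response** (S1 of the line `linear-response-lip`,
explicit-hypothesis form).  See the module docstring. -/
theorem responseL2Envelope {γ : ℝ} (hγ : γ ∈ Icc (5 : ℝ) 8) {ρN : ℕ} (hρN : ρN ∈ Finset.Icc 2 7)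
    (hK2 : K2PhaseGrowthClassical ⟨γ, 1 / 4, 2, 1, ρN⟩ 3) :
    ∃ M₂ K : ℝ, 0 ≤ M₂ ∧ M₂ < γ ^ 2 - 3 ∧ 0 ≤ K ∧
      ∀ A : ℕ, ∃ ν₀ : ℝ, 0 < ν₀ ∧ ∀ ν ∈ Ioc 0 ν₀, ∀ T' : ℝ,
        DriftFree.horizon (γ ^ 2 - 3) ν A < T' → T' < 1 →
        ∀ (L : ℝ → UnitAddTorus (Fin 2) → EuclideanSpace ℝ (Fin 2)) (q : ℝ → UnitAddTorus (Fin 2) → ℝ),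
          Torus.IsSmoothSpaceTimeOn (Icc 0 T') L → Torus.IsSmoothSpaceTimeOn (Icc 0 T') q →
          (∀ t ∈ Icc 0 T', Torus.IsDivFree (L t)) → L 0 = 0 →
          (∀ t ∈ Icc 0 T', ∀ x, Torus.timeDerivWithin (Icc 0 T') L t x +
            Torus.convect ((⟨γ, 1 / 4, 2, 1, ρN⟩ : CascadeParams).field t) (L t) x +
            Torus.convect (L t) ((⟨γ, 1 / 4, 2, 1, ρN⟩ : CascadeParams).field t) x =
              ν • Torus.laplacian (L t) x - Torus.gradient (q t) x +
                ν • Torus.laplacian ((⟨γ, 1 / 4, 2, 1, ρN⟩ : CascadeParams).field t) x) →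
          ∀ j : ℕ, ∀ t ∈ Icc 0 (DriftFree.horizon (γ ^ 2 - 3) ν A),
            t ∈ Icc (CascadeParams.tStart j) (CascadeParams.tStart (j + 1)) →
            Real.sqrt (Torus.vectorL2Sq (L t)) ≤ K * ν * ((j : ℝ) + 1) * M₂ ^ (j + 1) := by
  set P : CascadeParams := ⟨γ, 1 / 4, 2, 1, ρN⟩ with hP
  obtain ⟨hρ2, hρ7⟩ := Finset.mem_Icc.1 hρN
  have hρ1 : 1 ≤ ρN := le_trans (by norm_num) hρ2
  have hγ0 : 0 ≤ γ := le_trans (by norm_num) hγ.1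
  set M : ℝ := max (3 * Real.exp (sawSigmaStar * γ)) (2 * ρN) with hM
  set K : ℝ := (96 * Real.sqrt Real.pi + 24 * Real.sqrt (2 * Real.pi)) * γ with hK
  have hM1 : 1 ≤ M := le_max_of_le_right (by
    have : (2 : ℝ) ≤ ρN := by exact_mod_cast hρ2
    linarith)
  have hM0 : 0 ≤ M := zero_le_one.trans hM1
  have hMlt : M < γ ^ 2 - 3 := by
    refine max_lt (DriftFree.driftFreeWindow58 γ hγ) ?_
    have : (ρN : ℝ) ≤ 7 := by exact_mod_cast hρ7
    nlinarith [hγ.1]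
  have hK0 : 0 ≤ K := by rw [hK]; positivity
  refine ⟨M, K, hM0, hMlt, hK0, fun A => ?_⟩
  obtain ⟨ν₁, hν₁, hK2ν⟩ := hK2
  obtain ⟨νb, hνb, hbud⟩ := budget_threshold hγ hρN A
  refine ⟨min ν₁ νb, lt_min hν₁ hνb, fun ν hν T' hT hT'1 L q hL hq hLdiv hL0 hlin j t ht htj => ?_⟩
  have hν0 : 0 < ν := hν.1
  have hν₁' : ν ∈ Ioc 0 ν₁ := ⟨hν.1, hν.2.trans (min_le_left _ _)⟩
  have hνb' : ν ∈ Ioc 0 νb := ⟨hν.1, hν.2.trans (min_le_right _ _)⟩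
  have hRHS : 0 ≤ K * ν * ((j : ℝ) + 1) * M ^ (j + 1) := by positivity
  -- the horizon phase
  set JT : ℕ := Jrate (γ ^ 2 - 3) ν + A with hJT
  have hT_eq : DriftFree.horizon (γ ^ 2 - 3) ν A = tStart JT := rfl
  rw [hT_eq] at ht hT
  -- trivial case `t = 0`
  by_cases ht0 : t = 0
  · subst ht0
    have h0 : Torus.vectorL2Sq (L 0) = 0 := by
      rw [hL0]; simp [Torus.vectorL2Sq]
    rw [h0, Real.sqrt_zero]
    exact hRHS
  have htpos : 0 < t := lt_of_le_of_ne ht.1 (Ne.symm ht0)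
  have hJT1 : 1 ≤ JT := by
    by_contra h
    have h0 : JT = 0 := by omega
    have : tStart JT = 0 := by rw [h0]; rfl
    linarith [ht.2]
  -- locate the slot of `t` among the `2 JT` slots before the horizon
  have hK2JT : CascadeParams.tInject (2 * JT / 2) (2 * JT % 2 == 0) = tStart JT := slotStart_even JT
  obtain ⟨k, hk, htk, hk0⟩ := exists_slot ht.1 (by omega : 0 < 2 * JT) (by rw [hK2JT]; exact ht.2)
  -- the envelope at phase `JT - 1`
  have hJT' : JT - 1 + 1 = JT := by omega
  have hbud' : ∀ j' ≤ JT - 1, 16 * Real.pi ^ 2 * ν * ((P.N j' : ℕ) : ℝ) ^ 2 * tHalf j' ≤ P.δ j' ^ 2 :=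
    fun j' hj' => hbud ν hνb' j' (by omega)
  have hJTT : tStart (JT - 1 + 1) ≤ T' := by rw [hJT']; exact hT.le
  have hk' : k < 2 * (JT - 1 + 1) := by rw [hJT']; exact hk
  have hL0' : L 0 = fun _ => 0 := hL0
  have henv := response_envelope_of_budget P (by norm_num [hP]) (by norm_num [hP]) hγ0
    (fun j => box_N_ne_zero γ (by omega) j) hν0 (by norm_num : (0 : ℝ) ≤ 3) (hK2ν ν hν₁') hbud' hJTT hT'1
    hL hq hLdiv hL0' hlin hk' htk
  have hC₁0 : 0 ≤ 3 * Real.exp (sawSigmaStar * γ) := by positivity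
  have h2 := box_sum_le γ hγ0 hρ1 hν0.le hC₁0 k
  have hkj : k / 2 ≤ j := by
    rcases hk0 with h0 | hlt
    · simp [h0]
    · have h1 : tStart (k / 2) < tStart (j + 1) := hlt.trans_le htj.2
      have h2 := tStart_strictMono.lt_iff_lt.1 h1
      omega
  have hKν : 0 ≤ K * ν := mul_nonneg hK0 hν0.le
  calc Real.sqrt (Torus.vectorL2Sq (L t)) ≤ _ := henv
    _ ≤ (96 * Real.sqrt Real.pi + 24 * Real.sqrt (2 * Real.pi)) * γ * ν * (((k / 2 : ℕ) : ℝ) + 1) *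
          (max (3 * Real.exp (sawSigmaStar * γ)) (2 * ρN)) ^ (k / 2 + 1) := h2
    _ = (K * ν) * ((((k / 2 : ℕ) : ℝ) + 1) * M ^ (k / 2 + 1)) := by rw [hK, hM]; ring
    _ ≤ (K * ν) * (((j : ℝ) + 1) * M ^ (j + 1)) := mul_le_mul_of_nonneg_left (envelope_mono hM1 hkj) hKν
    _ = K * ν * ((j : ℝ) + 1) * M ^ (j + 1) := by ring

end Summit.AnomalousDissipation.AnomalousDissipation.Theorems.SawtoothPulseCascade.ApproxResponse

end
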